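import Literature.NumberTheory.EllipticCurves.TwoIsogenyLocalImageNode
import HarnessLib

/-!
# Bookkeeping for complete `2`-isogeny descents: exponent vectors of `K(S, 2)`-classes and products in `α(W(K))`

Topic `NumberTheory/EllipticCurves`. Small generic lemmas used when a complete `2`-isogeny descent over a number field
(Silverman *AEC* X.4.9; tree `KubertTate289CubicShaPhi`, `KubertTate289CubicShaPhiHat`) enumerates the classes of
`K(S, 2)` as products of a fixed list of generators: a sublist of `[a, b, c]` (resp. `[a, b, c, d, e]`) has product
`a^{e₁} b^{e₂} c^{e₃}` (resp. `⋯ e^{e₅}`) with exponents in `{0, 1}`; square classes are unchanged by square factors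
along ring homomorphisms; and products of powers of classes in the image `α(W(K))` of the Kummer map stay in it
(`α` is a homomorphism, Silverman–Tate §3.5). Theorems only.

## References
* [SilvermanAEC2009] J. H. Silverman, *The Arithmetic of Elliptic Curves*, 2nd ed. (2009), Prop. X.4.9, Thm. X.1.1(c).
* [SilvermanTate2015] J. H. Silverman, J. Tate, *Rational Points on Elliptic Curves*, 2nd ed. (2015), §3.5.
-/

noncomputable section

open scoped Classical

namespace WeierstrassCurve

open _root_.WeierstrassCurve.Affine

/-- A sublist of `[a, b, c]` has product `a^{e₁} b^{e₂} c^{e₃}` with `eᵢ ∈ {0, 1}` — the exponent vector of a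
`K(S, 2)`-class on three generators. [cite: SilvermanAEC2009, Thm. X.1.1(c)] -/
theorem prod_eq_pow_of_sublist_three {M : Type*} [CommMonoid M] (a b c : M) {l : List M}
    (h : l.Sublist [a, b, c]) :
    ∃ e₁ e₂ e₃ : ℕ, e₁ ≤ 1 ∧ e₂ ≤ 1 ∧ e₃ ≤ 1 ∧ l.prod = a ^ e₁ * b ^ e₂ * c ^ e₃ := by
  rcases List.sublist_cons_iff.mp h with h1 | ⟨l₁, rfl, h1⟩
  · rcases List.sublist_cons_iff.mp h1 with h2 | ⟨l₂, rfl, h2⟩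
    · rcases List.sublist_cons_iff.mp h2 with h3 | ⟨l₃, rfl, h3⟩
      · rw [List.sublist_nil] at h3; subst h3
        exact ⟨0, 0, 0, by omega, by omega, by omega, by simp⟩
      · rw [List.sublist_nil] at h3; subst h3
        exact ⟨0, 0, 1, by omega, by omega, by omega, by simp⟩
    · rcases List.sublist_cons_iff.mp h2 with h3 | ⟨l₃, rfl, h3⟩
      · rw [List.sublist_nil] at h3; subst h3
        exact ⟨0, 1, 0, by omega, by omega, by omega, by simp⟩
      · rw [List.sublist_nil] at h3; subst h3
        exact ⟨0, 1, 1, by omega, by omega, by omega, by simp⟩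
  · rcases List.sublist_cons_iff.mp h1 with h2 | ⟨l₂, rfl, h2⟩
    · rcases List.sublist_cons_iff.mp h2 with h3 | ⟨l₃, rfl, h3⟩
      · rw [List.sublist_nil] at h3; subst h3
        exact ⟨1, 0, 0, by omega, by omega, by omega, by simp⟩
      · rw [List.sublist_nil] at h3; subst h3
        exact ⟨1, 0, 1, by omega, by omega, by omega, by simp⟩
    · rcases List.sublist_cons_iff.mp h2 with h3 | ⟨l₃, rfl, h3⟩
      · rw [List.sublist_nil] at h3; subst h3
        exact ⟨1, 1, 0, by omega, by omega, by omega, by simp⟩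
      · rw [List.sublist_nil] at h3; subst h3
        exact ⟨1, 1, 1, by omega, by omega, by omega, by simp [mul_assoc]⟩

/-- A sublist of `[a, b, c, d, e]` has product `a^{e₁} ⋯ e^{e₅}` with `eᵢ ∈ {0, 1}`. [cite: SilvermanAEC2009, Thm. X.1.1(c)] -/
theorem prod_eq_pow_of_sublist_five {M : Type*} [CommMonoid M] (a b c d e : M) {l : List M}
    (h : l.Sublist [a, b, c, d, e]) :
    ∃ e₁ e₂ e₃ e₄ e₅ : ℕ, e₁ ≤ 1 ∧ e₂ ≤ 1 ∧ e₃ ≤ 1 ∧ e₄ ≤ 1 ∧ e₅ ≤ 1 ∧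
      l.prod = a ^ e₁ * b ^ e₂ * c ^ e₃ * d ^ e₄ * e ^ e₅ := by
  rcases List.sublist_cons_iff.mp h with h1 | ⟨l₁, rfl, h1⟩
  · rcases List.sublist_cons_iff.mp h1 with h2 | ⟨l₂, rfl, h2⟩
    · obtain ⟨e₃, e₄, e₅, h₃, h₄, h₅, hp⟩ := prod_eq_pow_of_sublist_three c d e h2
      exact ⟨0, 0, e₃, e₄, e₅, by omega, by omega, h₃, h₄, h₅, by rw [hp]; simp [mul_assoc]⟩
    · obtain ⟨e₃, e₄, e₅, h₃, h₄, h₅, hp⟩ := prod_eq_pow_of_sublist_three c d e h2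
      exact ⟨0, 1, e₃, e₄, e₅, by omega, by omega, h₃, h₄, h₅, by rw [List.prod_cons, hp]; simp [mul_assoc]⟩
  · rcases List.sublist_cons_iff.mp h1 with h2 | ⟨l₂, rfl, h2⟩
    · obtain ⟨e₃, e₄, e₅, h₃, h₄, h₅, hp⟩ := prod_eq_pow_of_sublist_three c d e h2
      exact ⟨1, 0, e₃, e₄, e₅, by omega, by omega, h₃, h₄, h₅, by rw [List.prod_cons, hp]; simp [mul_assoc]⟩
    · obtain ⟨e₃, e₄, e₅, h₃, h₄, h₅, hp⟩ := prod_eq_pow_of_sublist_three c d e h2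
      exact ⟨1, 1, e₃, e₄, e₅, by omega, by omega, h₃, h₄, h₅, by
        rw [List.prod_cons, List.prod_cons, hp]; simp [mul_assoc]⟩

variable {K : Type*} [Field K]

/-- `[f(d w²)] = [f(d)]` along a ring homomorphism of fields (`d w² ≠ 0`). [cite: SilvermanTate2015, §3.5] -/
theorem sqClass_map_eq_of_eq_mul_sq {F : Type*} [Field F] (f : K →+* F) {q d w : K} (hq : q ≠ 0)
    (h : q = d * w ^ 2) : sqClass (f q) = sqClass (f d) := by
  have hd : d ≠ 0 := by rintro rfl; exact hq (by rw [h, zero_mul])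
  have hw : w ≠ 0 := by rintro rfl; exact hq (by rw [h]; ring)
  rw [h, map_mul, map_pow, mul_comm]
  exact sqClass_sq_mul ((map_ne_zero f).mpr hw) ((map_ne_zero f).mpr hd)

/-- **Products of powers (exponents `≤ 1`) of three classes of `α(W(K))` lie in `α(W(K))`** (`α` is a homomorphism).
[cite: SilvermanTate2015, §3.5] -/
theorem sqClass_pow_mul_pow_mul_pow_mem {W : WeierstrassCurve K} [W.IsTwoTorsionNF] [W.IsElliptic] {x y z : K}
    (hx : x ≠ 0) (hy : y ≠ 0) (hz : z ≠ 0) (mx : sqClass x ∈ Set.range W.xSqClass)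
    (my : sqClass y ∈ Set.range W.xSqClass) (mz : sqClass z ∈ Set.range W.xSqClass) {a b c : ℕ} (ha : a ≤ 1)
    (hb : b ≤ 1) (hc : c ≤ 1) : sqClass (x ^ a * y ^ b * z ^ c) ∈ Set.range W.xSqClass := by
  have mul_mem : ∀ {s₁ s₂ : SqUnits K}, s₁ ∈ Set.range W.xSqClass → s₂ ∈ Set.range W.xSqClass →
      s₁ * s₂ ∈ Set.range W.xSqClass := by
    rintro _ _ ⟨P, rfl⟩ ⟨Q, rfl⟩; exact ⟨P + Q, xSqClass_add W P Q⟩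
  have m1 : sqClass (1 : K) ∈ Set.range W.xSqClass :=
    ⟨0, by rw [xSqClass_zero]; exact ((sqClass_eq_one_iff one_ne_zero).mpr ⟨1, by ring⟩).symm⟩
  rcases Nat.le_one_iff_eq_zero_or_eq_one.mp ha with rfl | rfl <;>
    rcases Nat.le_one_iff_eq_zero_or_eq_one.mp hb with rfl | rfl <;>
    rcases Nat.le_one_iff_eq_zero_or_eq_one.mp hc with rfl | rfl <;>
    simp only [pow_zero, pow_one, mul_one, one_mul]
  · exact m1
  · exact mz
  · exact my
  · rw [sqClass_mul hy hz]; exact mul_mem my mz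
  · exact mx
  · rw [sqClass_mul hx hz]; exact mul_mem mx mz
  · rw [sqClass_mul hx hy]; exact mul_mem mx my
  · rw [sqClass_mul (mul_ne_zero hx hy) hz, sqClass_mul hx hy]; exact mul_mem (mul_mem mx my) mz

end WeierstrassCurve

end
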